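import Summits.Ventures.HSemireg.WedgePointPairPowers

/-!
# Venture HSemireg — THEOREM K iterated over ANY finite splitting; the MIXED box of point pairs of dimensions `m₀, …, m_{n−1}`: `Π_i P_{m_i}(t)`

HONEST FRAMING. Part of the Lean index of the computation cell `pub-hsemireg` (seat p10 gen 6, Sunday typer «UNIFORM-IN-n»).
Finite-dimensional EXTERIOR ALGEBRA over a field ONLY: no variety, no cohomology theory, no sheaf, no Ext group and no
semiregularity map is constructed here; nothing here says that HC / HC_CM / HC_AV holds; no Literature fact is declared or used.
Custodian versions cited: theory/FORMULA-N.md PART A §2.3 THEOREM K (th-6: «on `Y = X₁ × X₂` … rank polynomials MULTIPLY»), §2.5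
(«Boxes: multiply polynomials (K)»), PART B §N.3 / §N.7 (th-7); STRUCTURE.md v1.0-SIGNED 9b196a05977dd067 §1.1 (FORMULA-N Σ2).

The tree has THEOREM K for TWO disjointly supported homogeneous classes (`WedgeKunneth.rankPoly_mul`, with the remark «so the block form
iterates over any finite splitting») and the ITERATED box of `n` IDENTICAL `m`-dimensional point pairs (`WedgePointPairPowers.rankPoly_pairBox`
`= P_mⁿ`).  THIS FILE types the iteration itself and the box with factors of DIFFERENT dimensions:
* §1 **THEOREM K OVER ANY FINITE SPLITTING** (generic generators `I`; blocks `D 0, …, D (n−1)` pairwise disjoint; classes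
  `f i ∈ Hom (D i) (d i)`): the ordered product `prodR f j = f 0 ∧ ⋯ ∧ f (j−1)` is homogeneous of degree `Σ_{i<j} d i` on `⋃_{i<j} D i` and
  **`rankPoly_prodR`: `rankPoly_{⋃ D}(f 0 ∧ ⋯ ∧ f (n−1)) = Π_{i<n} rankPoly_{D i}(f i)`**; with `⋃ D = univ`:
  **`finrank_range_wedge_prodR`: `rank(θ ↦ θ ∧ Π f ∣ ⋀^k) = [t^k] Π_i rankPoly(f i)`**.
* §2 **THE MIXED POINT-PAIR BOX** (th-6's `Y = X₀ × ⋯ × X_{n−1}`, `dim X_i = m_i`): generators `Σₗ i : Fin n, Fin (m_i + m_i)` (lexicographic: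
  block `i` = the `2m_i` generators of factor `i`, th-7's point pair `a·E_{X_i} + c·E_{Y_i}` embedded along `j ↦ ⟨i, j⟩`);
  **`rankPoly_mixedBox`: the rank polynomial of `F = f₀ ∧ ⋯ ∧ f_{n−1}` is `Π_i pairPoly (m i) = Π_i P_{m_i}(t)`** (`m_i ≥ 1`, `a, c ≠ 0`),
  **`finrank_range_wedge_mixedBox`: `rank(θ ↦ θ ∧ F ∣ ⋀^k) = [t^k] Π_i P_{m_i}(t)`**, in `ℤ[X]` with th-6's `P`: `…_eq_coeff_P`;
  rows: a curve × a surface factor `(1+t)(1+4t+t²) = (1,5,5,1)`; a surface × a threefold factor `(1+4t+t²)(1+6t+6t²+t³) = (1,10,31,31,10,1)`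
  (`mixedRank_rows`, by `decide` from the closed coefficients).
Equal dimensions `m_i = m` give back `P_mⁿ` (`WedgePointPairPowers`), not re-derived.  Class side only; nothing Ext-side.
Namespace `Summit.Ventures.HSemireg.Wedge.MixedBox` (new); new names only.
-/

open Module Set Set.powersetCard Polynomial

namespace Summit.Ventures.HSemireg.Wedge.MixedBox

open Summit.Ventures.HSemireg.Wedge Summit.Ventures.HSemireg.Wedge.Kunneth

variable (K : Type*) [Field K] {I : Type*} [LinearOrder I] [Fintype I]

/-! ## §1. THEOREM K over any finite splitting -/

/-- the ordered product of the first `j` classes of a sequence: `prodR f j = f 0 ∧ f 1 ∧ ⋯ ∧ f (j−1)` (`prodR f 0 = 1`). -/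
noncomputable def prodR (f : ℕ → HT K I) : ℕ → HT K I
  | 0 => 1
  | j + 1 => prodR f j * f j

omit [LinearOrder I] [Fintype I] in
/-- `prodR f (j+1) = prodR f j ∧ f j`. -/
lemma prodR_succ (f : ℕ → HT K I) (j : ℕ) : prodR K f (j + 1) = prodR K f j * f j := rfl

omit [LinearOrder I] [Fintype I] in
/-- `prodR f 1 = f 0`. -/
lemma prodR_one (f : ℕ → HT K I) : prodR K f 1 = f 0 := by
  rw [prodR_succ, show prodR K f 0 = 1 from rfl, one_mul]

omit [Fintype I] in
/-- the union of the first `j + 1` blocks is the union of the first `j` and block `j`. -/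
lemma biUnion_range_succ (D : ℕ → Finset I) (j : ℕ) :
    (Finset.range (j + 1)).biUnion D = (Finset.range j).biUnion D ∪ D j := by
  rw [Finset.range_add_one, Finset.biUnion_insert, Finset.union_comm]

omit [Fintype I] in
/-- the first `j` blocks are disjoint from block `j` when the blocks are pairwise disjoint below `n > j`. -/
lemma disjoint_biUnion_range {n : ℕ} {D : ℕ → Finset I} (hD : ∀ i j, i < j → j < n → Disjoint (D i) (D j)) {j : ℕ}
    (hj : j < n) : Disjoint ((Finset.range j).biUnion D) (D j) := by
  rw [Finset.disjoint_biUnion_left]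
  intro i hi
  exact hD i j (Finset.mem_range.mp hi) hj

/-- **THEOREM K OVER ANY FINITE SPLITTING** (FORMULA-N PART A §2.3 iterated; th-7's remark «the block form iterates»): for pairwise
disjoint blocks `D 0, …, D (n−1)` and homogeneous classes `f i ∈ Hom (D i) (d i)`, every initial product `f 0 ∧ ⋯ ∧ f (j−1)`
(`1 ≤ j ≤ n`) is homogeneous of degree `Σ_{i<j} d i` on `⋃_{i<j} D i`, and **its rank polynomial is `Π_{i<j} rankPoly_{D i}(f i)`**. -/
theorem rankPoly_prodR {n : ℕ} {D : ℕ → Finset I} {d : ℕ → ℕ} {f : ℕ → HT K I}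
    (hf : ∀ i, i < n → f i ∈ Hom K I (D i) (d i)) (hD : ∀ i j, i < j → j < n → Disjoint (D i) (D j)) :
    ∀ j, 1 ≤ j → j ≤ n →
      prodR K f j ∈ Hom K I ((Finset.range j).biUnion D) (∑ i ∈ Finset.range j, d i) ∧
        rankPoly K I ((Finset.range j).biUnion D) (prodR K f j) = ∏ i ∈ Finset.range j, rankPoly K I (D i) (f i) := by
  intro j hj1 hjn
  induction j with
  | zero => omega
  | succ j ih =>
    have hj : j < n := by omega
    rcases Nat.eq_zero_or_pos j with rfl | hjpos
    · rw [prodR_one, zero_add, Finset.range_one, Finset.singleton_biUnion, Finset.sum_singleton, Finset.prod_singleton]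
      exact ⟨hf 0 hj, rfl⟩
    · obtain ⟨hHom, hPoly⟩ := ih hjpos (by omega)
      rw [prodR_succ, biUnion_range_succ, Finset.sum_range_succ, Finset.prod_range_succ]
      exact ⟨mul_mem_Hom K (disjoint_biUnion_range hD hj) hHom (hf j hj),
        by rw [rankPoly_mul K (disjoint_biUnion_range hD hj) hHom (hf j hj), hPoly]⟩

/-- **`rank(θ ↦ θ ∧ (f 0 ∧ ⋯ ∧ f (n−1)) ∣ ⋀^k) = [t^k] Π_{i<n} rankPoly_{D i}(f i)`** when the `n ≥ 1` blocks cover the generators. -/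
theorem finrank_range_wedge_prodR {n : ℕ} (hn : 1 ≤ n) {D : ℕ → Finset I} {d : ℕ → ℕ} {f : ℕ → HT K I}
    (hf : ∀ i, i < n → f i ∈ Hom K I (D i) (d i)) (hD : ∀ i j, i < j → j < n → Disjoint (D i) (D j))
    (hcov : (Finset.range n).biUnion D = Finset.univ) (k : ℕ) :
    finrank K (LinearMap.range (wedge K I k (prodR K f n))) = (∏ i ∈ Finset.range n, rankPoly K I (D i) (f i)).coeff k := by
  rw [← V_univ, ← coeff_rankPoly, ← hcov, (rankPoly_prodR K hf hD n hn le_rfl).2]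

/-! ## §2. The mixed box of point pairs of dimensions `m 0, …, m (n−1)` -/

section Mixed

variable {n : ℕ} (m : Fin n → ℕ)

/-- generators of the mixed model: `Σₗ i : Fin n, Fin (m i + m i)`, ordered lexicographically (factor by factor). -/
abbrev Gen : Type := Σₗ i : Fin n, Fin (m i + m i)

/-- the order embedding of factor `i`'s `2 m_i` generators: `j ↦ ⟨i, j⟩`. -/
def facEmb (i : Fin n) : Fin (m i + m i) ↪o Gen m :=
  OrderEmbedding.ofStrictMono (fun j => toLex ⟨i, j⟩) fun _ _ h => Sigma.Lex.lt_def.mpr (Or.inr ⟨rfl, h⟩)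

/-- the value of the factor embedding. -/
@[simp] lemma facEmb_apply (i : Fin n) (j : Fin (m i + m i)) : facEmb m i j = toLex ⟨i, j⟩ := rfl

/-- block `i` of the mixed model (empty for `i ≥ n`), indexed by `ℕ` for §1. -/
def blk (i : ℕ) : Finset (Gen m) :=
  if h : i < n then Finset.univ.map (facEmb m ⟨i, h⟩).toEmbedding else ∅

/-- membership in block `i < n`: the first component is `i`. -/
lemma mem_blk {i : ℕ} (hi : i < n) {x : Gen m} : x ∈ blk m i ↔ ((ofLex x).1 : ℕ) = i := by
  rw [blk, dif_pos hi, Finset.mem_map]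
  constructor
  · rintro ⟨j, -, rfl⟩
    rfl
  · intro h
    obtain ⟨i', j⟩ := x
    have hi' : i' = ⟨i, hi⟩ := Fin.ext h
    subst hi'
    exact ⟨j, Finset.mem_univ _, rfl⟩

/-- the blocks are pairwise disjoint. -/
lemma blk_disjoint : ∀ i j, i < j → j < n → Disjoint (blk m i) (blk m j) := by
  intro i j hij hj
  rw [Finset.disjoint_left]
  intro x hxi hxj
  rw [mem_blk m (by omega)] at hxi
  rw [mem_blk m hj] at hxj
  omega

/-- factor `i`'s point pair `a·E_{X_i} + c·E_{Y_i}` (dimension `m i`), embedded into the mixed model (`1` for `i ≥ n`). -/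
noncomputable def fac (a c : K) (i : ℕ) : HT K (Gen m) :=
  if h : i < n then emb K (facEmb m ⟨i, h⟩) (PairPowers.pp K (m ⟨i, h⟩) a c) else 1

/-- factor `i < n` is homogeneous of degree `m i` on block `i`. -/
lemma fac_mem_Hom (a c : K) {i : ℕ} (hi : i < n) :
    fac K m a c i ∈ Hom K (Gen m) (blk m i) (m ⟨i, hi⟩) := by
  rw [fac, dif_pos hi, blk, dif_pos hi]
  exact emb_mem_Hom K _ (PairPowers.pp_mem_Hom K _ a c)

/-- **factor `i`'s rank polynomial on its block is `pairPoly (m i) = P_{m_i}`** (THEOREM T glued by `finrank_V_emb`; `m i ≥ 1`,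
`a, c ≠ 0`). -/
theorem rankPoly_fac {a c : K} (ha : a ≠ 0) (hc : c ≠ 0) {i : ℕ} (hi : i < n) (hm : 1 ≤ m ⟨i, hi⟩) :
    rankPoly K (Gen m) (blk m i) (fac K m a c i) = PairPowers.pairPoly (m ⟨i, hi⟩) := by
  ext k
  rw [coeff_rankPoly, fac, dif_pos hi, blk, dif_pos hi, finrank_V_emb, PairPowers.coeff_pairPoly]
  split_ifs with hk
  · exact WedgePair.finrank_range_wedgeMap_pointPair K (by omega) hk ha hc
  · rw [PairPowers.range_wedge_pp_eq_bot K (by omega), finrank_bot]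

/-- **THE MIXED BOX `F = f₀ ∧ ⋯ ∧ f_{n−1}`** of point pairs of dimensions `m 0, …, m (n−1)` (model of `ch` of an external product of
point-pair objects on `Y = X₀ × ⋯ × X_{n−1}`, `dim X_i = m_i`, sign-blind). -/
noncomputable def mixedBox (a c : K) : HT K (Gen m) := prodR K (fac K m a c) n

/-- THEOREM K for the mixed box, raw form: `rankPoly(F) = Π_{i<n} rankPoly_{block i}(f_i)` (the blocks cover the generators;
`DecidableEq` on the `Σₗ` generators is taken from the linear order, as in §1 — hence the `convert`). -/
theorem rankPoly_mixedBox_raw (hn : 1 ≤ n) (a c : K) :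
    rankPoly K (Gen m) Finset.univ (mixedBox K m a c) = ∏ i ∈ Finset.range n, rankPoly K (Gen m) (blk m i) (fac K m a c i) := by
  have h := (rankPoly_prodR K (f := fac K m a c) (d := fun i => if h : i < n then m ⟨i, h⟩ else 0)
    (fun i hi => by rw [dif_pos hi]; exact fac_mem_Hom K m a c hi) (blk_disjoint m) n hn le_rfl).2
  rw [mixedBox]
  convert h using 2
  ext x
  simp only [Finset.mem_univ, Finset.mem_biUnion, Finset.mem_range, true_iff]
  exact ⟨(ofLex x).1, (ofLex x).1.2, (mem_blk m (ofLex x).1.2).mpr rfl⟩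

/-- **THEOREM K FOR THE MIXED BOX: `rankPoly(F) = Π_{i<n} P_{m_i}(t)`** (`n ≥ 1`, every `m_i ≥ 1`, `a, c ≠ 0`). -/
theorem rankPoly_mixedBox (hn : 1 ≤ n) (hm : ∀ i, 1 ≤ m i) {a c : K} (ha : a ≠ 0) (hc : c ≠ 0) :
    rankPoly K (Gen m) Finset.univ (mixedBox K m a c) =
      ∏ i ∈ Finset.range n, if h : i < n then PairPowers.pairPoly (m ⟨i, h⟩) else 1 := by
  rw [rankPoly_mixedBox_raw K m hn a c]
  refine Finset.prod_congr rfl fun i hi => ?_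
  have hi' : i < n := Finset.mem_range.mp hi
  rw [dif_pos hi', rankPoly_fac K m ha hc hi' (hm _)]

/-- the same product written over `Fin n`: `Π_{i : Fin n} pairPoly (m i)`. -/
theorem rankPoly_mixedBox_fin (hn : 1 ≤ n) (hm : ∀ i, 1 ≤ m i) {a c : K} (ha : a ≠ 0) (hc : c ≠ 0) :
    rankPoly K (Gen m) Finset.univ (mixedBox K m a c) = ∏ i : Fin n, PairPowers.pairPoly (m i) := by
  rw [rankPoly_mixedBox K m hn hm ha hc, ← Fin.prod_univ_eq_prod_range (fun i => if h : i < n then PairPowers.pairPoly (m ⟨i, h⟩) else 1)]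
  refine Finset.prod_congr rfl fun i _ => ?_
  rw [dif_pos i.2]

/-- **`rank(θ ↦ θ ∧ F ∣ ⋀^k) = [t^k] Π_i P_{m_i}(t)`** for the mixed box (`n ≥ 1`, `m_i ≥ 1`, `a, c ≠ 0`; every field, every `k`). -/
theorem finrank_range_wedge_mixedBox (hn : 1 ≤ n) (hm : ∀ i, 1 ≤ m i) {a c : K} (ha : a ≠ 0) (hc : c ≠ 0) (k : ℕ) :
    finrank K (LinearMap.range (wedge K (Gen m) k (mixedBox K m a c))) = (∏ i : Fin n, PairPowers.pairPoly (m i)).coeff k := by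
  rw [← V_univ, ← coeff_rankPoly, rankPoly_mixedBox_fin K m hn hm ha hc]

/-- the same in `ℤ[X]` with th-6's `P`: **`rank = [t^k] Π_i P_{m_i}(t)`**, `P_m = 2(1+t)^m − 1 − t^m`. -/
theorem finrank_range_wedge_mixedBox_eq_coeff_P (hn : 1 ≤ n) (hm : ∀ i, 1 ≤ m i) {a c : K} (ha : a ≠ 0) (hc : c ≠ 0) (k : ℕ) :
    (finrank K (LinearMap.range (wedge K (Gen m) k (mixedBox K m a c))) : ℤ) = (∏ i : Fin n, FormulaN.Uniform.P (m i)).coeff k := by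
  rw [finrank_range_wedge_mixedBox K m hn hm ha hc]
  have h : ∀ i : Fin n, (PairPowers.pairPoly (m i)).map (Nat.castRingHom ℤ) = FormulaN.Uniform.P (m i) := by
    intro i
    ext j
    rw [coeff_map, eq_natCast, PairPowers.coeff_pairPoly_cast]
  rw [← Finset.prod_congr rfl (fun i _ => h i), ← Polynomial.map_prod, coeff_map, eq_natCast]

end Mixed

/-! ## §3. Two closed rows -/

/-- computable coefficient of a product of two point-pair polynomials: `Σ_{i ≤ k} r_i(m₁)·r_{k−i}(m₂)` (with `r_i(m) = 0` for `i > m`). -/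
def mixedRank₂ (m₁ m₂ k : ℕ) : ℕ :=
  ∑ i ∈ Finset.range (k + 1),
    (if i ≤ m₁ then WedgePair.pointPairRank m₁ i else 0) * (if k - i ≤ m₂ then WedgePair.pointPairRank m₂ (k - i) else 0)

/-- `[t^k] pairPoly m₁ · pairPoly m₂ = mixedRank₂ m₁ m₂ k`. -/
lemma coeff_pairPoly_mul_pairPoly (m₁ m₂ k : ℕ) :
    (PairPowers.pairPoly m₁ * PairPowers.pairPoly m₂).coeff k = mixedRank₂ m₁ m₂ k := by
  rw [coeff_mul, Finset.Nat.sum_antidiagonal_eq_sum_range_succ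
    (fun i j => (PairPowers.pairPoly m₁).coeff i * (PairPowers.pairPoly m₂).coeff j) k, mixedRank₂]
  refine Finset.sum_congr rfl fun i _ => ?_
  rw [PairPowers.coeff_pairPoly, PairPowers.coeff_pairPoly]

/-- **two mixed rows**: a CURVE factor times a SURFACE factor, `P_1 P_2 = (1+t)(1+4t+t²)`: wedge ranks `(1, 5, 5, 1)` on `⋀⁰..⋀³` of `K⁶`
(the same profile as the sub-torus ideal `I_{E×pt×pt}` of THEOREM T′ — both are `(1+t)·P_2`); a SURFACE times a THREEFOLD factor,
`P_2 P_3 = (1+4t+t²)(1+6t+6t²+t³)`: `(1, 10, 31, 31, 10, 1)` on `⋀⁰..⋀⁵` of `K^{10}`. -/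
theorem mixedRank_rows :
    (mixedRank₂ 1 2 0, mixedRank₂ 1 2 1, mixedRank₂ 1 2 2, mixedRank₂ 1 2 3, mixedRank₂ 1 2 4) = (1, 5, 5, 1, 0) ∧
    (mixedRank₂ 2 3 0, mixedRank₂ 2 3 1, mixedRank₂ 2 3 2, mixedRank₂ 2 3 3, mixedRank₂ 2 3 4, mixedRank₂ 2 3 5, mixedRank₂ 2 3 6) =
      (1, 10, 31, 31, 10, 1, 0) := by
  decide

/-- the two-factor mixed box as a RANK statement: factors of dimensions `m 0 = m₁`, `m 1 = m₂` (`≥ 1`), `a, c ≠ 0`: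
`rank(θ ↦ θ ∧ (f₀ ∧ f₁) ∣ ⋀^k) = mixedRank₂ m₁ m₂ k = [t^k] P_{m₁} P_{m₂}`. -/
theorem finrank_range_wedge_mixedBox_two {m₁ m₂ : ℕ} (h₁ : 1 ≤ m₁) (h₂ : 1 ≤ m₂) {a c : K} (ha : a ≠ 0) (hc : c ≠ 0) (k : ℕ) :
    finrank K (LinearMap.range (wedge K (Gen ![m₁, m₂]) k (mixedBox K ![m₁, m₂] a c))) = mixedRank₂ m₁ m₂ k := by
  rw [finrank_range_wedge_mixedBox K _ (by norm_num) (fun i => by fin_cases i <;> assumption) ha hc, Fin.prod_univ_two]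
  simp only [Matrix.cons_val_zero, Matrix.cons_val_one, coeff_pairPoly_mul_pairPoly]

end Summit.Ventures.HSemireg.Wedge.MixedBox
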